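import Summits.Parity.GeneralizedHardyLittlewood.Theorems.GreenTaoLevelTwoMNTwoBracketHeis

/-!
# Route `GreenTaoLevelTwo`, crux `MNTwo` (stmt-Parity-21276), line `birth`, stub `stub_mnVertical`:
# GT 2008b App. A (Prop. 5) — the BRACKET FRAME of the re-metrised Heisenberg nilmanifold

Block V7 of the `stub_mnVertical` census (B. Green, T. Tao, *Quadratic uniformity of the Möbius
function*, Ann. Inst. Fourier 58 (2008) = arXiv:math/0606087, App. A, Prop. 5: a `2`-step
nilsequence is an average of `1`-step nilsequences twisted by locally quadratic phases; "completely
explicit when the group `G` is a product of Heisenberg groups").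

A BRACKET FRAME of a nilmanifold `Y = (G/Γ, d)` is the def-free datum from which Prop. 5 is read
off for VERTICAL CHARACTERS: horizontal coordinates `π : G → ℝ^I` (a homomorphism), a finite
Lipschitz `ℤ^I`-periodic partition of unity `(χ_p)_(p ∈ P)` of the torus `ℝ^I/ℤ^I`, continuous
`Γ`-periodic sections `σ_p : ℝ^I → G` that are Lipschitz into `(G/Γ, d)`, and central parts
`ζ_p : G → Z(G)` with `w ∈ ζ_p(w) σ_p(π w) Γ` on `supp χ_p ∘ π` whose alternating products over
`3`-cubes `g^(n+e·h) x₀` inside that support are trivial (local quadraticity of the vertical phase):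

`∃ I P π χ σ ζ K, 0 ≤ K ∧ (π hom) ∧ (χ ≥ 0) ∧ (∑ χ = 1) ∧ (χ periodic) ∧ (χ K-Lipschitz) ∧
  (σ periodic mod Γ) ∧ (σ K-Lipschitz into G/Γ at scale ≤ 1) ∧ (ζ central) ∧
  (w = ζ σ(π w) γ on the support) ∧ (cube condition)`.

This file proves it for `heisenbergWith d h`, `d` box-comparable (constant `L`): `I = Bool`
(`π(w)(false) = x`, `π(w)(true) = y`), `P = Fin 4` quarter-tents in the `y`-coordinate (`…MNTwoTorusPartition`,
`m = 4`), sections `σ_j(u) = (u₀, λ_j(u₁), 0)` with the continuous periodic lift `λ_j` of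
`…MNTwoBracketHeis`, central parts `ζ_j(w) = (0, 0, z − x(y − λ_j(y)))`, `K = 3L + 4`
(`bracketFrame_heis` in the coordinates of `H³(ℝ)`, `bracketFrame_heisenbergWith` for the
`Nilmanifold` structure — the same statement, definitionally).  Products, powers, the circle and
the point inherit / carry bracket frames (sequel files), whence every `X^m × ℝ/ℤ`, `X ∈ 𝒞₂(H_d)`.

References: [GreenTao2008QuadraticMobius] arXiv:math/0606087, App. A, Prop. 5.
-/

noncomputable section

open Literature.NumberTheory.Sieve
open Literature.NumberTheory.Sieve.GreenTaoLevelTwo (HX IsCompatMetric IsBoxComparable heisenbergWith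
  boxGauge heisPreDist)
open Summit.Parity.GeneralizedHardyLittlewood.GreenTaoLevelTwoMNTwoCentralTranslation
open Summit.Parity.GeneralizedHardyLittlewood.GreenTaoLevelTwoMNTwoBracketHeis

namespace Summit.Parity.GeneralizedHardyLittlewood.GreenTaoLevelTwoMNTwoBracketFrameHeis

/-- The four quarter-tents sum to `1`. [folklore] -/
theorem sum_quarterTent_eq_one (b : ℝ) :
    ∑ p : Fin 4, max 0 (1 - (4 : ℝ) * ‖((b - ((p : ℕ) : ℝ) / 4 : ℝ) : AddCircle (1 : ℝ))‖) = 1 := by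
  have h := GreenTaoLevelTwoMNTwoTorusPartition.sum_tent_eq_one (m := 4) (by norm_num) b
  rw [Finset.sum_range] at h
  simpa only [Nat.cast_ofNat] using h

/-- The quarter-tents are `4`-Lipschitz for the sup-distance of `ℝ²` in the second coordinate.
[folklore] -/
theorem abs_quarterTent_sub_le (p : ℕ) (u u' : Bool → ℝ) :
    |max 0 (1 - (4 : ℝ) * ‖((u true - (p : ℝ) / 4 : ℝ) : AddCircle (1 : ℝ))‖) -
        max 0 (1 - (4 : ℝ) * ‖((u' true - (p : ℝ) / 4 : ℝ) : AddCircle (1 : ℝ))‖)| ≤ 4 * dist u u' := by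
  have h := GreenTaoLevelTwoMNTwoTorusPartition.abs_tent_sub_tent_le 4 p (u true) (u' true)
  simp only [Nat.cast_ofNat] at h
  refine h.trans (mul_le_mul_of_nonneg_left ?_ (by norm_num))
  refine (GreenTaoLevelTwoMNTwoRotationBohrSize.norm_coe_le_abs' _).trans ?_
  rw [← Real.dist_eq]
  exact dist_le_pi_dist u u' true

/-- The box gauge of `(a, v, 0)(a', v', 0)⁻¹` at scale `δ ≤ 1` with `|v'| ≤ 2` is at most `3δ`.
[cite: GreenTao2008U3Inverse, §12 (the cube metric)] -/
theorem boxGauge_section_le {a a' v v' δ : ℝ} (ha : |a - a'| ≤ δ) (hv : |v - v'| ≤ δ)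
    (hv' : |v'| ≤ 2) (hδ : δ ≤ 1) :
    boxGauge (Heis.mk a v 0 * (Heis.mk a' v' 0)⁻¹) ≤ 3 * δ := by
  have hδ0 : 0 ≤ δ := (abs_nonneg _).trans ha
  apply GreenTaoLevelTwo.boxGauge_le_of_abs_le
  · simp only [Heis.x_mul, Heis.x_mk, Heis.x_inv]
    rw [← sub_eq_add_neg]; linarith
  · simp only [Heis.y_mul, Heis.y_mk, Heis.y_inv]
    rw [← sub_eq_add_neg]; linarith
  · simp only [Heis.z_mul, Heis.z_mk, Heis.z_inv, Heis.x_mk, Heis.y_mk, Heis.y_inv]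
    rw [show (0 : ℝ) + (-0 + a' * v') + a * -v' = -((a - a') * v') by ring, abs_neg, abs_mul]
    nlinarith [abs_nonneg (a - a'), abs_nonneg v']
  · simp only [Heis.z_inv, Heis.z_mul, Heis.x_mul, Heis.y_mul, Heis.z_mk, Heis.x_mk, Heis.y_mk,
      Heis.x_inv, Heis.y_inv]
    rw [show -(0 + (-0 + a' * v') + a * -v') + (a + -a') * (v + -v') =
      (a - a') * v' + (a - a') * (v - v') by ring]
    refine (abs_add_le _ _).trans ?_
    rw [abs_mul, abs_mul]
    nlinarith [abs_nonneg (a - a'), abs_nonneg v', abs_nonneg (v - v')]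

/-- **Bracket frame of `(H³(ℝ)/H³(ℤ), d)` in coordinates** (`d` box-comparable): torus `ℝ²/ℤ²`
of the horizontal coordinates, four pieces, `K = 3L + 4`.
[cite: GreenTao2008QuadraticMobius, App. A, Prop. 5 (Heisenberg case)] -/
theorem bracketFrame_heis (d : HX → HX → ℝ) (hd : IsBoxComparable d) :
    ∃ (I : Type) (_ : Fintype I) (P : Type) (_ : Fintype P)
        (π : Heis → (I → ℝ)) (χ : P → (I → ℝ) → ℝ) (σ : P → (I → ℝ) → Heis)
        (ζ : P → Heis → Heis) (K : ℝ), 0 ≤ K ∧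
        (∀ g g' : Heis, π (g * g') = π g + π g') ∧
        (∀ p u, 0 ≤ χ p u) ∧
        (∀ u, ∑ p, χ p u = 1) ∧
        (∀ p u (v : I → ℤ), χ p (u + fun i => (v i : ℝ)) = χ p u) ∧
        (∀ p u u', |χ p u - χ p u'| ≤ K * dist u u') ∧
        (∀ p u (v : I → ℤ), ∃ γ ∈ Heis.latticeΓ, σ p (u + fun i => (v i : ℝ)) = σ p u * γ) ∧
        (∀ p u u', dist u u' ≤ 1 →
          d (σ p u : HX) (σ p u' : HX) ≤ K * dist u u') ∧
        (∀ p w, ζ p w ∈ Subgroup.center Heis) ∧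
        (∀ p w, χ p (π w) ≠ 0 → ∃ γ ∈ Heis.latticeΓ, w = ζ p w * σ p (π w) * γ) ∧
        (∀ p (g x₀ : Heis) (n h₁ h₂ h₃ : ℤ),
          (∀ e₁ e₂ e₃ : ℕ, e₁ ≤ 1 → e₂ ≤ 1 → e₃ ≤ 1 →
            χ p (π (g ^ (n + e₁ * h₁ + e₂ * h₂ + e₃ * h₃) * x₀)) ≠ 0) →
          ζ p (g ^ (n + h₁ + h₂ + h₃) * x₀) * (ζ p (g ^ (n + h₁ + h₂) * x₀))⁻¹ *
            (ζ p (g ^ (n + h₁ + h₃) * x₀))⁻¹ * (ζ p (g ^ (n + h₂ + h₃) * x₀))⁻¹ *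
            ζ p (g ^ (n + h₁) * x₀) * ζ p (g ^ (n + h₂) * x₀) * ζ p (g ^ (n + h₃) * x₀) *
            (ζ p (g ^ n * x₀))⁻¹ = 1) := by
  obtain ⟨L, hL0, hL⟩ := hd
  refine ⟨Bool, inferInstance, Fin 4, inferInstance,
    fun (w : Heis) (b : Bool) => cond b w.y w.x,
    fun (p : Fin 4) (u : Bool → ℝ) =>
      max 0 (1 - (4 : ℝ) * ‖((u true - ((p : ℕ) : ℝ) / 4 : ℝ) : AddCircle (1 : ℝ))‖),
    fun (p : Fin 4) (u : Bool → ℝ) => Heis.mk (u false)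
      (((p : ℕ) : ℝ) / 4 + 5 / 4 - ‖((u true - ((p : ℕ) : ℝ) / 4 - 1 / 4 : ℝ) : AddCircle (1 : ℝ))‖) 0,
    fun (p : Fin 4) (w : Heis) => Heis.mk 0 0 (w.z - w.x * (w.y -
      (((p : ℕ) : ℝ) / 4 + 5 / 4 - ‖((w.y - ((p : ℕ) : ℝ) / 4 - 1 / 4 : ℝ) : AddCircle (1 : ℝ))‖))),
    3 * L + 4, by positivity, fun g g' => ?_, fun p u => le_max_left _ _, fun u => ?_,
    fun p u v => ?_, fun p u u' => ?_, fun p u v => ?_, fun p u u' huu' => ?_,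
    fun p w => mk_zero_zero_mem_center _, fun p w hw => bracket_decomposition p w hw,
    fun p g x₀ n h₁ h₂ h₃ hsupp => ?_⟩
  · -- `π` is a homomorphism
    funext b
    cases b <;> rfl
  · -- partition of unity
    exact sum_quarterTent_eq_one (u true)
  · -- `χ` is `ℤ²`-periodic
    simp only [Pi.add_apply]
    rw [show (u true + ((v true : ℤ) : ℝ) - ((p : ℕ) : ℝ) / 4 : ℝ) =
      (u true - ((p : ℕ) : ℝ) / 4) + (v true : ℤ) by ring, GreenTaoLevelTwoGITwoCyclicInverse.coe_add_int_eq]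
  · -- `χ` is Lipschitz
    refine (abs_quarterTent_sub_le p u u').trans ?_
    exact mul_le_mul_of_nonneg_right (by linarith) dist_nonneg
  · -- `σ` is periodic modulo `Γ`
    refine ⟨Heis.mk (v false) 0 0, by simpa using Heis.mk_int_mem (v false) 0 0, ?_⟩
    simp only [Pi.add_apply]
    apply Heis.ext
    · simp
    · simp only [Heis.y_mul, Heis.y_mk, add_zero]
      exact lift_periodic p (u true) (v true)
    · simp
  · -- `σ` is Lipschitz into `(H/Γ, d)` at scale `≤ 1`
    have hδ0 : 0 ≤ dist u u' := dist_nonneg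
    have h0 : |u false - u' false| ≤ dist u u' := by
      rw [← Real.dist_eq]; exact dist_le_pi_dist u u' false
    have h1 : |u true - u' true| ≤ dist u u' := by
      rw [← Real.dist_eq]; exact dist_le_pi_dist u u' true
    have hv := (abs_lift_sub_lift_le p (u true) (u' true)).trans h1
    have hv' : |((p : ℕ) : ℝ) / 4 + 5 / 4 -
        ‖((u' true - ((p : ℕ) : ℝ) / 4 - 1 / 4 : ℝ) : AddCircle (1 : ℝ))‖| ≤ 2 := by
      obtain ⟨hlo, hhi⟩ := lift_mem_Icc p (u' true)
      have hp : ((p : ℕ) : ℝ) ≤ 3 := by exact_mod_cast Nat.lt_succ_iff.mp p.2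
      rw [abs_le]; constructor <;> linarith
    have hbox := boxGauge_section_le h0 hv hv' huu'
    calc d _ _ ≤ L * heisPreDist _ _ := (hL _ _).2
      _ ≤ L * boxGauge (Heis.mk (u false) (((p : ℕ) : ℝ) / 4 + 5 / 4 -
            ‖((u true - ((p : ℕ) : ℝ) / 4 - 1 / 4 : ℝ) : AddCircle (1 : ℝ))‖) 0 *
            ((1 : Heis.latticeΓ) : Heis) *
            (Heis.mk (u' false) (((p : ℕ) : ℝ) / 4 + 5 / 4 -
              ‖((u' true - ((p : ℕ) : ℝ) / 4 - 1 / 4 : ℝ) : AddCircle (1 : ℝ))‖) 0)⁻¹) :=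
          mul_le_mul_of_nonneg_left (GreenTaoLevelTwo.heisPreDist_mk_le _ _ 1) hL0.le
      _ ≤ L * (3 * dist u u') := by
          rw [Subgroup.coe_one, mul_one]
          exact mul_le_mul_of_nonneg_left hbox hL0.le
      _ ≤ (3 * L + 4) * dist u u' := by nlinarith
  · -- the cube condition (local quadraticity of the central part)
    have hsupp' : ∀ e₁ e₂ e₃ : ℕ, e₁ ≤ 1 → e₂ ≤ 1 → e₃ ≤ 1 →
        max 0 (1 - (4 : ℝ) * ‖(((g ^ (n + e₁ * h₁ + e₂ * h₂ + e₃ * h₃) * x₀).y -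
          ((p : ℕ) : ℝ) / 4 : ℝ) : AddCircle (1 : ℝ))‖) ≠ 0 :=
      fun e₁ e₂ e₃ a b c => hsupp e₁ e₂ e₃ a b c
    have key := bracket_cube p g x₀ n h₁ h₂ h₃ hsupp'
    beta_reduce
    beta_reduce at key
    exact key

/-- **Transport of the Heisenberg bracket frame along a group isomorphism**: any nilmanifold
`Y` whose group is identified with `H³(ℝ)` by a multiplicative equivalence `e` carrying `Γ` onto
`H³(ℤ)` and the metric onto a box-comparable `d` carries a bracket frame (pull back `π`, push the
sections and central parts through `e⁻¹`). [cite: GreenTao2008QuadraticMobius, App. A, Prop. 5 (Heisenberg case)] -/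
theorem bracketFrame_of_mulEquiv {s : ℕ} (Y : Nilmanifold s) (d : HX → HX → ℝ)
    (hd : IsBoxComparable d) (e : Y.G ≃* Heis)
    (hΓ : ∀ γ : Y.G, γ ∈ Y.Γ ↔ e γ ∈ Heis.latticeΓ)
    (hdist : ∀ x y : Y.G, Y.dist (x : Y.G ⧸ Y.Γ) (y : Y.G ⧸ Y.Γ) = d (e x : HX) (e y : HX)) :
    ∃ (I : Type) (_ : Fintype I) (P : Type) (_ : Fintype P)
        (π : (Y).G → (I → ℝ)) (χ : P → (I → ℝ) → ℝ) (σ : P → (I → ℝ) → (Y).G)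
        (ζ : P → (Y).G → (Y).G) (K : ℝ), 0 ≤ K ∧
        (∀ g g' : (Y).G, π (g * g') = π g + π g') ∧
        (∀ p u, 0 ≤ χ p u) ∧
        (∀ u, ∑ p, χ p u = 1) ∧
        (∀ p u (v : I → ℤ), χ p (u + fun i => (v i : ℝ)) = χ p u) ∧
        (∀ p u u', |χ p u - χ p u'| ≤ K * dist u u') ∧
        (∀ p u (v : I → ℤ), ∃ γ ∈ (Y).Γ, σ p (u + fun i => (v i : ℝ)) = σ p u * γ) ∧
        (∀ p u u', dist u u' ≤ 1 →
          (Y).dist (σ p u : (Y).G ⧸ (Y).Γ) (σ p u' : (Y).G ⧸ (Y).Γ) ≤ K * dist u u') ∧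
        (∀ p w, ζ p w ∈ Subgroup.center (Y).G) ∧
        (∀ p w, χ p (π w) ≠ 0 → ∃ γ ∈ (Y).Γ, w = ζ p w * σ p (π w) * γ) ∧
        (∀ p (g x₀ : (Y).G) (n h₁ h₂ h₃ : ℤ),
          (∀ e₁ e₂ e₃ : ℕ, e₁ ≤ 1 → e₂ ≤ 1 → e₃ ≤ 1 →
            χ p (π (g ^ (n + e₁ * h₁ + e₂ * h₂ + e₃ * h₃) * x₀)) ≠ 0) →
          ζ p (g ^ (n + h₁ + h₂ + h₃) * x₀) * (ζ p (g ^ (n + h₁ + h₂) * x₀))⁻¹ *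
            (ζ p (g ^ (n + h₁ + h₃) * x₀))⁻¹ * (ζ p (g ^ (n + h₂ + h₃) * x₀))⁻¹ *
            ζ p (g ^ (n + h₁) * x₀) * ζ p (g ^ (n + h₂) * x₀) * ζ p (g ^ (n + h₃) * x₀) *
            (ζ p (g ^ n * x₀))⁻¹ = 1) := by
  obtain ⟨I, iI, P, iP, π, χ, σ, ζ, K, hK, hπ, hχ0, hχ1, hχper, hχlip, hσper, hσlip, hζ, hbr, hcube⟩ :=
    bracketFrame_heis d hd
  refine ⟨I, iI, P, iP, fun w => π (e w), χ, fun p u => e.symm (σ p u),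
    fun p w => e.symm (ζ p (e w)), K, hK, fun g g' => ?_, hχ0, hχ1, hχper, hχlip, fun p u v => ?_,
    fun p u u' huu' => ?_, fun p w => ?_, fun p w hw => ?_, fun p g x₀ n h₁ h₂ h₃ hsupp => ?_⟩
  · -- `π ∘ e` is a homomorphism
    show π (e (g * g')) = π (e g) + π (e g')
    rw [map_mul]; exact hπ _ _
  · -- periodicity of the transported sections
    obtain ⟨γ, hγ, hσ⟩ := hσper p u v
    refine ⟨e.symm γ, (hΓ _).mpr (by simpa using hγ), ?_⟩
    show e.symm (σ p (u + fun i => (v i : ℝ))) = e.symm (σ p u) * e.symm γ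
    rw [hσ, map_mul]
  · -- Lipschitz bound of the transported sections
    show Y.dist (e.symm (σ p u) : Y.G ⧸ Y.Γ) (e.symm (σ p u') : Y.G ⧸ Y.Γ) ≤ K * dist u u'
    rw [hdist, MulEquiv.apply_symm_apply, MulEquiv.apply_symm_apply]
    exact hσlip p u u' huu'
  · -- centrality is preserved
    rw [Subgroup.mem_center_iff]
    intro g
    apply e.injective
    rw [map_mul, map_mul, MulEquiv.apply_symm_apply]
    exact Subgroup.mem_center_iff.mp (hζ p (e w)) (e g)
  · -- the bracket decomposition
    obtain ⟨γ, hγ, hwd⟩ := hbr p (e w) hw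
    refine ⟨e.symm γ, (hΓ _).mpr (by simpa using hγ), ?_⟩
    have key := congrArg e.symm hwd
    simp only [map_mul, MulEquiv.symm_apply_apply] at key
    beta_reduce
    exact key
  · -- the cube condition
    have hsupp' : ∀ e₁ e₂ e₃ : ℕ, e₁ ≤ 1 → e₂ ≤ 1 → e₃ ≤ 1 →
        χ p (π ((e g) ^ (n + e₁ * h₁ + e₂ * h₂ + e₃ * h₃) * e x₀)) ≠ 0 := by
      intro e₁ e₂ e₃ a b c
      have h' := hsupp e₁ e₂ e₃ a b c
      beta_reduce at h'
      rwa [map_mul, map_zpow] at h'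
    have key := congrArg e.symm (hcube p (e g) (e x₀) n h₁ h₂ h₃ hsupp')
    simp only [map_mul, map_inv, map_one] at key
    beta_reduce
    simp only [map_mul, map_zpow]
    exact key

/-- **The re-metrised Heisenberg nilmanifold `heisenbergWith d h` (box-comparable `d`) carries a
bracket frame** — `bracketFrame_heis` transported along the identity.
[cite: GreenTao2008QuadraticMobius, App. A, Prop. 5 (Heisenberg case)] -/
theorem bracketFrame_heisenbergWith (d : HX → HX → ℝ) (h : IsCompatMetric d)
    (hd : IsBoxComparable d) :
    ∃ (I : Type) (_ : Fintype I) (P : Type) (_ : Fintype P)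
        (π : (heisenbergWith d h).G → (I → ℝ)) (χ : P → (I → ℝ) → ℝ) (σ : P → (I → ℝ) → (heisenbergWith d h).G)
        (ζ : P → (heisenbergWith d h).G → (heisenbergWith d h).G) (K : ℝ), 0 ≤ K ∧
        (∀ g g' : (heisenbergWith d h).G, π (g * g') = π g + π g') ∧
        (∀ p u, 0 ≤ χ p u) ∧
        (∀ u, ∑ p, χ p u = 1) ∧
        (∀ p u (v : I → ℤ), χ p (u + fun i => (v i : ℝ)) = χ p u) ∧
        (∀ p u u', |χ p u - χ p u'| ≤ K * dist u u') ∧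
        (∀ p u (v : I → ℤ), ∃ γ ∈ (heisenbergWith d h).Γ, σ p (u + fun i => (v i : ℝ)) = σ p u * γ) ∧
        (∀ p u u', dist u u' ≤ 1 →
          (heisenbergWith d h).dist (σ p u : (heisenbergWith d h).G ⧸ (heisenbergWith d h).Γ) (σ p u' : (heisenbergWith d h).G ⧸ (heisenbergWith d h).Γ) ≤ K * dist u u') ∧
        (∀ p w, ζ p w ∈ Subgroup.center (heisenbergWith d h).G) ∧
        (∀ p w, χ p (π w) ≠ 0 → ∃ γ ∈ (heisenbergWith d h).Γ, w = ζ p w * σ p (π w) * γ) ∧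
        (∀ p (g x₀ : (heisenbergWith d h).G) (n h₁ h₂ h₃ : ℤ),
          (∀ e₁ e₂ e₃ : ℕ, e₁ ≤ 1 → e₂ ≤ 1 → e₃ ≤ 1 →
            χ p (π (g ^ (n + e₁ * h₁ + e₂ * h₂ + e₃ * h₃) * x₀)) ≠ 0) →
          ζ p (g ^ (n + h₁ + h₂ + h₃) * x₀) * (ζ p (g ^ (n + h₁ + h₂) * x₀))⁻¹ *
            (ζ p (g ^ (n + h₁ + h₃) * x₀))⁻¹ * (ζ p (g ^ (n + h₂ + h₃) * x₀))⁻¹ *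
            ζ p (g ^ (n + h₁) * x₀) * ζ p (g ^ (n + h₂) * x₀) * ζ p (g ^ (n + h₃) * x₀) *
            (ζ p (g ^ n * x₀))⁻¹ = 1) :=
  bracketFrame_of_mulEquiv (heisenbergWith d h) d hd (MulEquiv.refl _) (fun _ => Iff.rfl)
    (fun _ _ => rfl)

end Summit.Parity.GeneralizedHardyLittlewood.GreenTaoLevelTwoMNTwoBracketFrameHeis
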